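import Literature.NumberTheory.IwasawaTheory.FukudaGroupStep
import HarnessLib

/-!
# Fukuda's Theorem 1 at finite level — the GROUP-THEORETIC structure of ALL layers (Washington §13.3, Lemmas 13.15 and
# 13.18, in a finite Galois group): `N_j ∩ A = ν_j Y₀`, `N_j·G_j^p ∩ A = ν_j Y₀ + pA`, `[G_j : N_j] = [A : ν_j Y₀]`

Topic `NumberTheory/IwasawaTheory` (namespace = path). THEOREM-ONLY file (no definition, no named fact, no `sorry`), written by the
prover seat `bsd-potss-k8t-c4` g20 (cell `bsd-potss`; Fukuda road of stmt-BirchSwinnertonDyer-19982; closes nothing). It generalises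
brick (G) `FukudaGroupStep.lean` (which treated the subgroup of index `p` and one inclusion) to every layer and both inclusions; it is the
group-theoretic brick of the finite-level proof of Fukuda 1994 Thm. 1 (2) (`fukuda1994_thm1_classGroupPRank_const_of_succ_eq`,
`ClassicalMuInvariant.lean` §5).

THE SETTING (abstracting `G = Gal(H_p/K_n)`, `H_p` the `p`-Hilbert class field of `K_{n+t}`, `A = Gal(H_p/K_{n+t})`, `G_j = Gal(H_p/K_{n+j})`,
`𝓘` = the inertia groups of the primes of `H_p` over `K_n`): `G` finite, `A ◁ G` abelian, `g ∈ G` with `⟨g⟩ ∩ A = 1`, `A⟨g⟩ = G`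
(so `G/A ≅ ⟨g⟩` is cyclic, of order `p^t = [G : A]`), `𝓘` a set of subgroups with `I ∩ A = 1` and `I = 1` or `IA = G` for every `I ∈ 𝓘`
(«unramified in `H_p/K_{n+t}`; unramified or totally ramified in `K_{n+t}/K_n`»), `⟨g⟩ ∈ 𝓘`.  NOTATION inside the statements (all through
the plumbing definitions `conjEnd`, `subOf`, `liftSub` of brick (G)): `φ = conjEnd A g` (conjugation by `g` on `Additive A`),
`N₀ = G'·⟨I : I ∈ 𝓘⟩`, `Y₀ = subOf A N₀` (`= N₀ ∩ A`), `ν_j = ∑_{i<p^j} φ^i`, and for a subgroup `G_j ⊇ A` of index `p^j` (`j ≤ t`):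
`N_j = G_j'·⟨I ∩ G_j : I ∈ 𝓘⟩`, `P_j` = the subgroup generated by the `p`-th powers of the elements of `G_j`, `pA` = the image of
multiplication by `p` on `Additive A`.

RESULTS (Washington Lemma 13.15 «`𝒢̃' = TX`», Lemma 13.18 «`Y_n = ν_n Y_0`», finite level, with the elementary-abelian companion):
* `subOf_commutator_sup_eq_span` — `Y₀` is the span of `(φ − 1)A` and the `a_I` (`a_I g ∈ I`); `map_sub_one_mem_subOf_commutator_sup`,
  `conjEnd_mem_subOf_commutator_sup` — `(φ − 1)A ⊆ Y₀`, `Y₀` is `φ`-stable;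
* `layer_eq_sup_zpowers` — `G_j = A·⟨g^{p^j}⟩`;
* `commutator_sup_layer_eq`, `commutator_sup_layer_inf_eq` — `N_j = ν_j(Y₀)·⟨g^{p^j}⟩` and **`N_j ∩ A = ν_j(Y₀)`**;
* `relIndex_commutator_sup_layer_mul_card` — **`[G_j : N_j] · #ν_j(Y₀) = #A`**;
* `commutator_sup_layer_pow_inf_eq`, `relIndex_commutator_sup_layer_pow_mul_card` — **`N_j P_j ∩ A = ν_j(Y₀) + pA`**,
  `[G_j : N_j P_j]·#(ν_j Y₀ + pA) = #A`;
* `map_subOf_commutator_sup_index_eq_bot` — `ν_t(Y₀) = 0` for `p^t = [G : A]`; `conjEnd_pow_index_eq_one` — `φ^{p^t} = 1`.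

References: [Washington1997] L. Washington, *Introduction to Cyclotomic Fields*, 2nd ed., §13.3 Lemmas 13.14–13.18, Prop. 13.22;
[Fukuda1994] T. Fukuda, Proc. Japan Acad. 70 A (1994), Thm. 1 and its proof, p. 264.
-/

noncomputable section

open Subgroup Finset
open scoped IsMulCommutative commutatorElement

namespace Literature.NumberTheory.IwasawaTheory.FukudaGroup

variable {G : Type*} [Group G] (A : Subgroup G) [A.Normal] [IsMulCommutative A]

/-! ## §1 Plumbing for `conjEnd`, `subOf`, `liftSub` (re-proved: the versions of brick (G) are private) -/

/-- Unfolding `conjEnd`: `conjEnd A g (ofMul a) = ofMul (g a g⁻¹)`. [folklore] -/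
private theorem coe_toMul_conjEnd' (g : G) (x : Additive A) :
    ((Additive.toMul (conjEnd A g x) : A) : G) = g * (Additive.toMul x : A) * g⁻¹ := rfl

omit [A.Normal] in
/-- Unfolding `subOf`. [folklore] -/
private theorem mem_subOf' {N : Subgroup G} {x : Additive A} : x ∈ subOf A N ↔ ((Additive.toMul x : A) : G) ∈ N := Iff.rfl

/-- `conjEnd` is multiplicative in `g`. [folklore] -/
private theorem conjEnd_mul' (g h : G) : conjEnd A (g * h) = conjEnd A g * conjEnd A h := by
  apply LinearMap.ext; intro x
  apply Additive.toMul.injective; apply Subtype.ext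
  simp only [coe_toMul_conjEnd', Module.End.mul_apply, mul_inv_rev, mul_assoc]

/-- `conjEnd A 1 = 1`. [folklore] -/
private theorem conjEnd_one' : conjEnd A (1 : G) = 1 := by
  apply LinearMap.ext; intro x
  apply Additive.toMul.injective; apply Subtype.ext
  simp only [coe_toMul_conjEnd', one_mul, inv_one, mul_one, Module.End.one_apply]

/-- `conjEnd A (g ^ n) = (conjEnd A g) ^ n`. [folklore] -/
private theorem conjEnd_pow' (g : G) (n : ℕ) : conjEnd A (g ^ n) = conjEnd A g ^ n := by
  induction n with
  | zero => rw [pow_zero, pow_zero, conjEnd_one']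
  | succ n ih => rw [pow_succ, conjEnd_mul', ih, pow_succ]

/-- Conjugation by an element of the abelian `A` is trivial on `A`. [folklore] -/
private theorem conjEnd_eq_one_of_mem' {a : G} (ha : a ∈ A) : conjEnd A a = 1 := by
  apply LinearMap.ext; intro x
  apply Additive.toMul.injective; apply Subtype.ext
  rw [coe_toMul_conjEnd', Module.End.one_apply, setLike_mul_comm ha (Additive.toMul x : A).2, mul_inv_cancel_right]

omit [A.Normal] in
/-- Membership in `liftSub`. [folklore] -/
private theorem mem_liftSub' {S : Submodule ℤ (Additive A)} {x : G} :
    x ∈ liftSub A S ↔ ∃ y : A, Additive.ofMul y ∈ S ∧ (y : G) = x := by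
  constructor
  · rintro ⟨y, hy, rfl⟩; exact ⟨y, hy, rfl⟩
  · rintro ⟨y, hy, rfl⟩; exact ⟨y, hy, rfl⟩

omit [A.Normal] in
/-- `ofMul y ∈ S ↔ (y : G) ∈ liftSub S`. [folklore] -/
private theorem coe_mem_liftSub_iff {S : Submodule ℤ (Additive A)} (y : A) : (y : G) ∈ liftSub A S ↔ Additive.ofMul y ∈ S := by
  rw [mem_liftSub']
  constructor
  · rintro ⟨y', hy', h⟩
    have : y' = y := Subtype.ext h
    rwa [← this]
  · intro h; exact ⟨y, h, rfl⟩

omit [A.Normal] in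
/-- `toMul x ∈ liftSub S ↔ x ∈ S`. [folklore] -/
private theorem toMul_mem_liftSub_iff {S : Submodule ℤ (Additive A)} (x : Additive A) :
    ((Additive.toMul x : A) : G) ∈ liftSub A S ↔ x ∈ S := by
  rw [coe_mem_liftSub_iff, ofMul_toMul]

omit [A.Normal] in
/-- `liftSub S ≤ A`. [folklore] -/
private theorem liftSub_le' (S : Submodule ℤ (Additive A)) : liftSub A S ≤ A := by
  rintro x hx
  obtain ⟨y, -, rfl⟩ := (mem_liftSub' A).mp hx
  exact y.2

omit [A.Normal] in
/-- `#liftSub S = #S`. [folklore] -/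
private theorem card_liftSub' (S : Submodule ℤ (Additive A)) : Nat.card (liftSub A S) = Nat.card S := by
  rw [liftSub, Subgroup.card_map_of_injective (Subgroup.subtype_injective A)]
  exact Nat.card_congr (Equiv.subtypeEquiv Additive.ofMul fun _ => Iff.rfl)

omit [A.Normal] in
/-- `liftSub (subOf N) = N ⊓ A`. [folklore] -/
private theorem liftSub_subOf' (N : Subgroup G) : liftSub A (subOf A N) = N ⊓ A := by
  ext x
  rw [mem_liftSub', Subgroup.mem_inf]
  constructor
  · rintro ⟨y, hy, rfl⟩; exact ⟨(mem_subOf' A).mp hy, y.2⟩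
  · rintro ⟨hN, hA⟩; exact ⟨⟨x, hA⟩, (mem_subOf' A).mpr hN, rfl⟩

omit [A.Normal] in
/-- `subOf (liftSub S) = S`. [folklore] -/
private theorem subOf_liftSub (S : Submodule ℤ (Additive A)) : subOf A (liftSub A S) = S := by
  ext x
  rw [mem_subOf', toMul_mem_liftSub_iff]

omit [A.Normal] in
/-- `subOf (N ⊓ A) = subOf N`. [folklore] -/
private theorem subOf_inf (N : Subgroup G) : subOf A (N ⊓ A) = subOf A N := by
  ext x
  rw [mem_subOf', mem_subOf', Subgroup.mem_inf]
  exact ⟨fun h => h.1, fun h => ⟨h, (Additive.toMul x : A).2⟩⟩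

omit [A.Normal] in
/-- `liftSub` is monotone. [folklore] -/
private theorem liftSub_mono {S T : Submodule ℤ (Additive A)} (h : S ≤ T) : liftSub A S ≤ liftSub A T := by
  intro x hx
  obtain ⟨y, hy, rfl⟩ := (mem_liftSub' A).mp hx
  exact (mem_liftSub' A).mpr ⟨y, h hy, rfl⟩

omit [A.Normal] in
/-- `liftSub (S ⊔ T) = liftSub S ⊔ liftSub T`. [folklore] -/
private theorem liftSub_sup (S T : Submodule ℤ (Additive A)) : liftSub A (S ⊔ T) = liftSub A S ⊔ liftSub A T := by
  apply le_antisymm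
  · intro x hx
    obtain ⟨y, hy, rfl⟩ := (mem_liftSub' A).mp hx
    obtain ⟨s, hs, t, ht, hst⟩ := Submodule.mem_sup.mp hy
    have : (y : G) = ((Additive.toMul s : A) : G) * ((Additive.toMul t : A) : G) := by
      rw [← Subgroup.coe_mul, ← toMul_add, hst, toMul_ofMul]
    rw [this]
    exact Subgroup.mul_mem_sup ((toMul_mem_liftSub_iff A _).mpr hs) ((toMul_mem_liftSub_iff A _).mpr ht)
  · exact sup_le (liftSub_mono A le_sup_left) (liftSub_mono A le_sup_right)

omit [A.Normal] in
/-- `liftSub S ≤ N ↔ S ≤ subOf N`. [folklore] -/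
private theorem liftSub_le_iff {S : Submodule ℤ (Additive A)} {N : Subgroup G} : liftSub A S ≤ N ↔ S ≤ subOf A N := by
  constructor
  · intro h x hx
    rw [mem_subOf']
    exact h ((toMul_mem_liftSub_iff A _).mpr hx)
  · intro h x hx
    obtain ⟨y, hy, rfl⟩ := (mem_liftSub' A).mp hx
    exact (mem_subOf' A).mp (h hy)

omit [A.Normal] [IsMulCommutative A] in
/-- A subgroup containing the commutator subgroup is normal. [folklore] -/
private theorem normal_of_commutator_le' {N : Subgroup G} (hN : ⁅(⊤ : Subgroup G), ⊤⁆ ≤ N) : N.Normal := by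
  refine ⟨fun n hn x => ?_⟩
  have hc : ⁅x, n⁆ ∈ N := hN (Subgroup.commutator_mem_commutator (Subgroup.mem_top x) (Subgroup.mem_top n))
  have : x * n * x⁻¹ = ⁅x, n⁆ * n := by rw [commutatorElement_def, inv_mul_cancel_right]
  rw [this]
  exact N.mul_mem hc hn

/-! ## §2 The layers `G_j = A·⟨g^{p^j}⟩` and their norm groups -/

section Layers

variable {A} [Finite G] {p : ℕ} [hp : Fact p.Prime]

omit [IsMulCommutative A] hp in
/-- Every element of `A ⊔ ⟨h⟩` is `a h^n` with `a ∈ A`, `n ∈ ℕ` (finite group). [folklore] -/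
private theorem exists_eq_mul_pow_of_mem {h x : G} (hx : x ∈ A ⊔ Subgroup.zpowers h) :
    ∃ a : A, ∃ n : ℕ, x = (a : G) * h ^ n := by
  rw [Subgroup.mem_sup_of_normal_left] at hx
  obtain ⟨y, hy, z, hz, rfl⟩ := hx
  rw [← mem_powers_iff_mem_zpowers] at hz
  obtain ⟨n, rfl⟩ := hz
  exact ⟨⟨y, hy⟩, n, rfl⟩

omit [IsMulCommutative A] hp in
/-- Every element of `G = A ⊔ ⟨g⟩` is `a g^n` with `a ∈ A`, `n ∈ ℕ`. [folklore] -/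
private theorem exists_eq_mul_pow' {g : G} (hgen : A ⊔ Subgroup.zpowers g = ⊤) (x : G) :
    ∃ a : A, ∃ n : ℕ, x = (a : G) * g ^ n :=
  exists_eq_mul_pow_of_mem (by rw [hgen]; exact Subgroup.mem_top x)

omit hp in
/-- `liftSub S` is normal when `S` is `φ`-stable, `φ` = conjugation by a generator `g` of `G` modulo `A`. [folklore] -/
private theorem liftSub_normal {g : G} (hgen : A ⊔ Subgroup.zpowers g = ⊤) {S : Submodule ℤ (Additive A)}
    (hS : ∀ y ∈ S, conjEnd A g y ∈ S) : (liftSub A S).Normal := by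
  have hSpow : ∀ n : ℕ, ∀ y ∈ S, (conjEnd A g ^ n) y ∈ S := by
    intro n
    induction n with
    | zero => intro y hy; simpa using hy
    | succ n ih => intro y hy; rw [pow_succ', Module.End.mul_apply]; exact hS _ (ih y hy)
  refine ⟨fun l hl x => ?_⟩
  obtain ⟨y, hy, rfl⟩ := (mem_liftSub' A).mp hl
  obtain ⟨a, n, rfl⟩ := exists_eq_mul_pow' hgen x
  have h1 : g ^ n * (y : G) * (g ^ n)⁻¹ ∈ liftSub A S := by
    have h2 : ((Additive.toMul ((conjEnd A g ^ n) (Additive.ofMul y)) : A) : G) = g ^ n * y * (g ^ n)⁻¹ := by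
      rw [← conjEnd_pow', coe_toMul_conjEnd', toMul_ofMul]
    rw [← h2]
    exact (toMul_mem_liftSub_iff A _).mpr (hSpow n _ hy)
  have h2 : (a : G) * (g ^ n * y * (g ^ n)⁻¹) * (a : G)⁻¹ = g ^ n * y * (g ^ n)⁻¹ := by
    rw [setLike_mul_comm a.2 (liftSub_le' A _ h1), mul_inv_cancel_right]
  rw [show (a : G) * g ^ n * ↑y * ((a : G) * g ^ n)⁻¹ = (a : G) * (g ^ n * y * (g ^ n)⁻¹) * (a : G)⁻¹ by group, h2]
  exact h1

omit [A.Normal] [Finite G] hp in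
/-- `T ∩ A = liftSub S` for `T = liftSub S ⊔ ⟨h⟩` whenever `⟨h⟩ ∩ A = 1` and `liftSub S` is normal. [folklore] -/
private theorem liftSub_sup_zpowers_inf_eq {h : G} (hhA : Subgroup.zpowers h ⊓ A = ⊥) (S : Submodule ℤ (Additive A))
    [(liftSub A S).Normal] : (liftSub A S ⊔ Subgroup.zpowers h) ⊓ A = liftSub A S := by
  apply le_antisymm
  · intro x hx
    obtain ⟨hxT, hxA⟩ := Subgroup.mem_inf.mp hx
    rw [Subgroup.mem_sup_of_normal_left] at hxT
    obtain ⟨l, hl, z, hz, rfl⟩ := hxT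
    have hzA : z ∈ A := by
      have h1 := A.mul_mem (A.inv_mem (liftSub_le' A _ hl)) hxA
      rwa [inv_mul_cancel_left] at h1
    have hz1 : z = 1 := by
      have hmem : z ∈ Subgroup.zpowers h ⊓ A := ⟨hz, hzA⟩
      rwa [hhA, Subgroup.mem_bot] at hmem
    rw [hz1, mul_one]
    exact hl
  · exact le_inf le_sup_left (liftSub_le' A _)

omit [A.Normal] [IsMulCommutative A] [Finite G] hp in
/-- `[K : T] · #(T ∩ A) = #A` whenever `A ◁ G`, `T, A ≤ K` and `A ⊔ T = K` (re-proved from brick (G), where it is private). [folklore] -/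
private theorem relIndex_mul_card_inf_eq' [A.Normal] [Finite G] {T K : Subgroup G} (hT : T ≤ K) (hAK : A ≤ K) (hsup : A ⊔ T = K) :
    T.relIndex K * Nat.card ↥(T ⊓ A) = Nat.card A := by
  have h1 : A.relIndex K = A.relIndex T := by rw [← hsup, sup_comm, Subgroup.relIndex_sup_right]
  have hA : A.relIndex K * Nat.card A = Nat.card K := by
    rw [Subgroup.relIndex, mul_comm, ← Nat.card_congr (Subgroup.subgroupOfEquivOfLe hAK).toEquiv, Subgroup.card_mul_index]
  have hTK : T.relIndex K * Nat.card T = Nat.card K := by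
    rw [Subgroup.relIndex, mul_comm, ← Nat.card_congr (Subgroup.subgroupOfEquivOfLe hT).toEquiv, Subgroup.card_mul_index]
  have hTA : A.relIndex T * Nat.card ↥(T ⊓ A) = Nat.card T := by
    rw [Subgroup.relIndex, mul_comm, ← Subgroup.inf_subgroupOf_left,
      ← Nat.card_congr (Subgroup.subgroupOfEquivOfLe (inf_le_left : T ⊓ A ≤ T)).toEquiv, Subgroup.card_mul_index]
  have hpos : 0 < A.relIndex T := Nat.pos_of_ne_zero (by rw [Subgroup.relIndex]; exact Subgroup.index_ne_zero_of_finite)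
  have key : A.relIndex T * (T.relIndex K * Nat.card ↥(T ⊓ A)) = A.relIndex T * Nat.card A := by
    calc A.relIndex T * (T.relIndex K * Nat.card ↥(T ⊓ A))
        = T.relIndex K * (A.relIndex T * Nat.card ↥(T ⊓ A)) := by ring
      _ = T.relIndex K * Nat.card T := by rw [hTA]
      _ = Nat.card K := hTK
      _ = A.relIndex K * Nat.card A := hA.symm
      _ = A.relIndex T * Nat.card A := by rw [h1]
  exact Nat.eq_of_mul_eq_mul_left hpos key

variable {g : G} {𝓘 : Set (Subgroup G)} {t : ℕ}

omit [A.Normal] [IsMulCommutative A] [Finite G] hp in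
/-- `⟨g⟩ ∩ A = 1`: a power of `g` lying in `A` is trivial. [folklore] -/
private theorem zpow_eq_one_of_mem (hgA : Subgroup.zpowers g ⊓ A = ⊥) {k : ℤ} (hk : g ^ k ∈ A) : g ^ k = 1 := by
  have : g ^ k ∈ Subgroup.zpowers g ⊓ A := ⟨Subgroup.zpow_mem_zpowers g k, hk⟩
  rwa [hgA, Subgroup.mem_bot] at this

omit [IsMulCommutative A] hp in
/-- **`ord g = p^t = [G : A]`** when `⟨g⟩ ∩ A = 1` and `A⟨g⟩ = G` (the generator `σ` of a totally ramified inertia group has order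
`[K_{n+t} : K_n]`). [cite: Washington1997, §13.3 Lemma 13.15 (set-up: `I₁ ∩ X = 1`, `I₁ ≅ Γ/Γ_n`)] -/
theorem orderOf_eq_index (hgA : Subgroup.zpowers g ⊓ A = ⊥) (hgen : A ⊔ Subgroup.zpowers g = ⊤) (hind : A.index = p ^ t) :
    orderOf g = p ^ t := by
  have h1 : (Subgroup.zpowers g).relIndex ⊤ * Nat.card ↥(Subgroup.zpowers g ⊓ A) = Nat.card A :=
    relIndex_mul_card_inf_eq' (A := A) (T := Subgroup.zpowers g) (K := ⊤) le_top le_top (by rw [hgen])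
  rw [hgA, Subgroup.card_bot, mul_one, Subgroup.relIndex_top_right] at h1
  -- `#⟨g⟩ · [G : ⟨g⟩] = #G = #A · [G : A]`
  have h2 := (Subgroup.zpowers g).card_mul_index
  rw [h1, ← A.card_mul_index, hind, Nat.card_zpowers, mul_comm] at h2
  exact Nat.eq_of_mul_eq_mul_left Nat.card_pos h2

omit [IsMulCommutative A] hp in
/-- `g^{p^t} = 1` for `p^t = [G : A]`. [cite: Washington1997, §13.3 Lemma 13.15 (set-up)] -/
theorem pow_index_eq_one (hgA : Subgroup.zpowers g ⊓ A = ⊥) (hgen : A ⊔ Subgroup.zpowers g = ⊤) (hind : A.index = p ^ t) :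
    g ^ p ^ t = 1 := by
  rw [← orderOf_eq_index hgA hgen hind]; exact pow_orderOf_eq_one g

omit hp in
/-- **`φ^{p^t} = 1`** for `φ = conjEnd A g`. [cite: Washington1997, §13.3 Lemma 13.15 (set-up)] -/
theorem conjEnd_pow_index_eq_one (hgA : Subgroup.zpowers g ⊓ A = ⊥) (hgen : A ⊔ Subgroup.zpowers g = ⊤) (hind : A.index = p ^ t) :
    conjEnd A g ^ p ^ t = 1 := by
  rw [← conjEnd_pow', pow_index_eq_one hgA hgen hind, conjEnd_one']

omit [IsMulCommutative A] hp in
/-- For a subgroup `Gj ⊇ A` of index `p^j`, every `p^j`-th power lies in `Gj` (`G/Gj` has order `p^j`). [folklore] -/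
private theorem pow_mem_layer (hgen : A ⊔ Subgroup.zpowers g = ⊤) {j : ℕ} {Gj : Subgroup G} (hAGj : A ≤ Gj)
    (hGj : Gj.index = p ^ j) (x : G) : x ^ p ^ j ∈ Gj := by
  -- `Gj` is normal: it contains the commutator subgroup, which lies in `A` (the quotient `G/A ≅ ⟨g⟩` is abelian)
  have hcommA : ⁅(⊤ : Subgroup G), ⊤⁆ ≤ A := by
    rw [Subgroup.commutator_le]
    intro x _ y _
    obtain ⟨a, m, rfl⟩ := exists_eq_mul_pow' hgen x
    obtain ⟨b, n, rfl⟩ := exists_eq_mul_pow' hgen y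
    -- `⁅a g^m, b g^n⁆ ∈ A`: compute modulo the normal subgroup `A`
    rw [← QuotientGroup.eq_one_iff, commutatorElement_def]
    simp only [QuotientGroup.mk_mul, QuotientGroup.mk_inv, (QuotientGroup.eq_one_iff (a : G)).mpr a.2,
      (QuotientGroup.eq_one_iff (b : G)).mpr b.2, one_mul, QuotientGroup.mk_pow]
    rw [← zpow_natCast, ← zpow_natCast]
    group
  haveI : Gj.Normal := normal_of_commutator_le' (hcommA.trans hAGj)
  rw [← QuotientGroup.eq_one_iff, QuotientGroup.mk_pow, ← hGj, Subgroup.index_eq_card]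
  exact pow_card_eq_one'

omit [IsMulCommutative A] in
/-- **`G_j = A·⟨g^{p^j}⟩`**: the subgroup of index `p^j` containing `A` (`j ≤ t`). [cite: Washington1997, §13.3 Lemma 13.15 (`G_n`)] -/
theorem layer_eq_sup_zpowers (hgA : Subgroup.zpowers g ⊓ A = ⊥) (hgen : A ⊔ Subgroup.zpowers g = ⊤) (hind : A.index = p ^ t)
    {j : ℕ} (hj : j ≤ t) {Gj : Subgroup G} (hAGj : A ≤ Gj) (hGj : Gj.index = p ^ j) :
    Gj = A ⊔ Subgroup.zpowers (g ^ p ^ j) := by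
  have hp0 : 0 < p := hp.out.pos
  -- `A ⊔ ⟨g^{p^j}⟩ ≤ Gj`
  have hle : A ⊔ Subgroup.zpowers (g ^ p ^ j) ≤ Gj :=
    sup_le hAGj ((Subgroup.zpowers_le).mpr (pow_mem_layer hgen hAGj hGj g))
  -- both have index `p^j`: compute the index of `A ⊔ ⟨g^{p^j}⟩` from `#⟨g^{p^j}⟩ = p^{t-j}`
  have hgjA : Subgroup.zpowers (g ^ p ^ j) ⊓ A = ⊥ := by
    rw [eq_bot_iff, ← hgA]
    exact inf_le_inf_right A ((Subgroup.zpowers_le).mpr (Subgroup.npow_mem_zpowers g _))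
  have hord : orderOf (g ^ p ^ j) = p ^ (t - j) := by
    rw [orderOf_pow' _ (pow_ne_zero j hp.out.ne_zero), orderOf_eq_index hgA hgen hind,
      Nat.gcd_eq_right (pow_dvd_pow p hj), Nat.pow_div hj hp0]
  have hindex : (A ⊔ Subgroup.zpowers (g ^ p ^ j)).index = p ^ j := by
    have h1 : (Subgroup.zpowers (g ^ p ^ j)).relIndex (A ⊔ Subgroup.zpowers (g ^ p ^ j)) *
        Nat.card ↥(Subgroup.zpowers (g ^ p ^ j) ⊓ A) = Nat.card A :=
      relIndex_mul_card_inf_eq' (A := A) le_sup_right le_sup_left rfl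
    rw [hgjA, Subgroup.card_bot, mul_one] at h1
    -- `#(A ⊔ ⟨g_j⟩) = [A ⊔ ⟨g_j⟩ : ⟨g_j⟩] · #⟨g_j⟩ = #A · p^{t-j}`
    have h2 : Nat.card ↥(A ⊔ Subgroup.zpowers (g ^ p ^ j)) = Nat.card A * p ^ (t - j) := by
      rw [← h1, ← hord, ← Nat.card_zpowers, Subgroup.relIndex, mul_comm,
        ← Nat.card_congr (Subgroup.subgroupOfEquivOfLe (le_sup_right : Subgroup.zpowers (g ^ p ^ j) ≤ _)).toEquiv,
        Subgroup.card_mul_index]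
    have h3 := (A ⊔ Subgroup.zpowers (g ^ p ^ j)).card_mul_index
    rw [h2, ← A.card_mul_index, hind, mul_assoc, ← pow_sub_mul_pow p hj] at h3
    have h4 := Nat.eq_of_mul_eq_mul_left Nat.card_pos h3
    exact Nat.eq_of_mul_eq_mul_left (pow_pos hp0 _) h4
  -- equal indices and `≤` force equality
  by_contra hne
  have hlt : A ⊔ Subgroup.zpowers (g ^ p ^ j) < Gj := lt_of_le_of_ne hle (Ne.symm hne)
  have := Subgroup.index_strictAnti hlt
  rw [hindex, hGj] at this
  exact lt_irrefl _ this

omit [IsMulCommutative A] hp in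
/-- The image of `g` generates `G/G_j`, which has order `p^j`: `ord(g G_j) = p^j`. [folklore] -/
private theorem orderOf_mk_layer (hgen : A ⊔ Subgroup.zpowers g = ⊤) {j : ℕ} {Gj : Subgroup G} [Gj.Normal] (hAGj : A ≤ Gj)
    (hGj : Gj.index = p ^ j) : orderOf (QuotientGroup.mk g : G ⧸ Gj) = p ^ j := by
  rw [← hGj, Subgroup.index_eq_card]
  apply orderOf_eq_card_of_forall_mem_zpowers
  intro q
  obtain ⟨x, rfl⟩ := QuotientGroup.mk_surjective q
  obtain ⟨a, n, rfl⟩ := exists_eq_mul_pow' hgen x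
  rw [QuotientGroup.mk_mul, (QuotientGroup.eq_one_iff (a : G)).mpr (hAGj a.2), one_mul, QuotientGroup.mk_pow]
  exact Subgroup.npow_mem_zpowers _ n

omit [IsMulCommutative A] hp in
/-- **A complement `I ∈ 𝓘` (`IA = G`, `I ∩ A = 1`) is cyclic, generated by `c = a_I g` with `a_I ∈ A`; its trace on `G_j` is
generated by `c^{p^j}`.** [cite: Washington1997, §13.3 Lemma 13.15 (the generators `σ_i = a_i σ_1`)] -/
private theorem exists_generator_of_complement (hgen : A ⊔ Subgroup.zpowers g = ⊤) {I : Subgroup G} (hIA : I ⊓ A = ⊥)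
    (hI : I ⊔ A = ⊤) :
    ∃ a : A, (a : G) * g ∈ I ∧ ∀ {j : ℕ} {Gj : Subgroup G} [Gj.Normal], A ≤ Gj → Gj.index = p ^ j →
      ∀ x ∈ I ⊓ Gj, ∃ m : ℕ, x = (((a : G) * g) ^ p ^ j) ^ m := by
  -- the lift `c = a g ∈ I` of `g`
  have hg : g ∈ I ⊔ A := by rw [hI]; exact Subgroup.mem_top g
  rw [Subgroup.mem_sup_of_normal_right] at hg
  obtain ⟨c, hc, z, hz, hcz⟩ := hg
  have hcg : c = ((⟨g * z⁻¹ * g⁻¹, ‹A.Normal›.conj_mem _ (A.inv_mem hz) g⟩ : A) : G) * g := by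
    simp only [← hcz]; group
  refine ⟨⟨g * z⁻¹ * g⁻¹, ‹A.Normal›.conj_mem _ (A.inv_mem hz) g⟩, hcg ▸ hc, ?_⟩
  intro j Gj _ hAGj hGj x hx
  rw [← hcg]
  obtain ⟨hxI, hxGj⟩ := Subgroup.mem_inf.mp hx
  -- every element of `I` is a natural power of `c`: `x = a' c^n`-decomposition inside `A ⊔ ⟨c⟩ = ⊤`
  have hgenc : A ⊔ Subgroup.zpowers c = ⊤ := by
    rw [eq_top_iff, ← hgen]
    refine sup_le le_sup_left ((Subgroup.zpowers_le).mpr ?_)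
    have : g = ((⟨g * z⁻¹ * g⁻¹, ‹A.Normal›.conj_mem _ (A.inv_mem hz) g⟩ : A) : G)⁻¹ * c := by
      rw [hcg, inv_mul_cancel_left]
    rw [this]
    exact Subgroup.mul_mem _ (Subgroup.mem_sup_left (A.inv_mem (SetLike.coe_mem _))) (Subgroup.mem_sup_right (Subgroup.mem_zpowers c))
  obtain ⟨a', n, hxn⟩ := exists_eq_mul_pow' hgenc x
  have ha'1 : (a' : G) = 1 := by
    have h1 : (a' : G) ∈ I ⊓ A := ⟨by
      have : (a' : G) = x * (c ^ n)⁻¹ := by rw [hxn, mul_inv_cancel_right]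
      rw [this]; exact I.mul_mem hxI (I.inv_mem (I.pow_mem hc n)), a'.2⟩
    rwa [hIA, Subgroup.mem_bot] at h1
  rw [ha'1, one_mul] at hxn
  -- `c^n ∈ Gj` forces `p^j ∣ n` (the image of `c` in `G/Gj` has order `p^j`)
  have hord : orderOf (QuotientGroup.mk c : G ⧸ Gj) = p ^ j := by
    have h1 : (QuotientGroup.mk c : G ⧸ Gj) = QuotientGroup.mk g := by
      rw [hcg, QuotientGroup.mk_mul, (QuotientGroup.eq_one_iff _).mpr (hAGj (SetLike.coe_mem _)), one_mul]
    rw [h1]; exact orderOf_mk_layer hgen hAGj hGj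
  have hdvd : p ^ j ∣ n := by
    rw [← hord, orderOf_dvd_iff_pow_eq_one, ← QuotientGroup.mk_pow, QuotientGroup.eq_one_iff, ← hxn]
    exact hxGj
  obtain ⟨m, rfl⟩ := hdvd
  exact ⟨m, by rw [hxn, pow_mul]⟩

/-- The core computation (Washington Lemmas 13.15 and 13.18 at finite level, BOTH inclusions): with `W₀` the span of `(φ − 1)A` and of the
`a ∈ A` with `a g ∈ I` for some `I ∈ 𝓘`, and `G_j ⊇ A` of index `p^j` (`j ≤ t`):
`G_j'·⟨I ∩ G_j : I ∈ 𝓘⟩ = liftSub(ν_j W₀)·⟨g^{p^j}⟩` and `(G_j'·⟨I ∩ G_j⟩·P_j) = liftSub(ν_j W₀ + pA)·⟨g^{p^j}⟩`.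
[cite: Washington1997, §13.3 Lemmas 13.15 and 13.18 (proofs)] -/
private theorem commutator_sup_layer_eq_aux (hgA : Subgroup.zpowers g ⊓ A = ⊥) (hgen : A ⊔ Subgroup.zpowers g = ⊤)
    (hind : A.index = p ^ t) (h𝓘 : ∀ I ∈ 𝓘, I ⊓ A = ⊥ ∧ (I = ⊥ ∨ I ⊔ A = ⊤)) (hg𝓘 : Subgroup.zpowers g ∈ 𝓘)
    (W₀ : Submodule ℤ (Additive A))
    (hW₀ : W₀ = Submodule.span ℤ (Set.range ⇑(conjEnd A g - 1) ∪ {x | ∃ I ∈ 𝓘, ((Additive.toMul x : A) : G) * g ∈ I}))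
    {j : ℕ} (hj : j ≤ t) {Gj : Subgroup G} (hAGj : A ≤ Gj) (hGj : Gj.index = p ^ j) :
    (⁅Gj, Gj⁆ ⊔ ⨆ I ∈ 𝓘, I ⊓ Gj =
        liftSub A (W₀.map (∑ i ∈ range (p ^ j), conjEnd A g ^ i)) ⊔ Subgroup.zpowers (g ^ p ^ j)) ∧
      ((⁅Gj, Gj⁆ ⊔ ⨆ I ∈ 𝓘, I ⊓ Gj) ⊔ Subgroup.closure ((fun x : G => x ^ p) '' (Gj : Set G)) =
        liftSub A (W₀.map (∑ i ∈ range (p ^ j), conjEnd A g ^ i) ⊔ (⊤ : Submodule ℤ (Additive A)).map ((p : ℤ) • (1 : Module.End ℤ (Additive A)))) ⊔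
          Subgroup.zpowers (g ^ p ^ j)) := by
  classical
  set φ : Module.End ℤ (Additive A) := conjEnd A g with hφ
  set ν : Module.End ℤ (Additive A) := ∑ i ∈ range (p ^ j), φ ^ i with hν
  set gj : G := g ^ p ^ j with hgj
  set Nj : Subgroup G := ⁅Gj, Gj⁆ ⊔ ⨆ I ∈ 𝓘, I ⊓ Gj with hNj
  set Pj : Subgroup G := Subgroup.closure ((fun x : G => x ^ p) '' (Gj : Set G)) with hPj
  -- ### generalities on `φ`, `W₀`, `ν`
  have hcommA : ⁅(⊤ : Subgroup G), ⊤⁆ ≤ A := by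
    rw [Subgroup.commutator_le]
    intro x _ y _
    obtain ⟨a, m, rfl⟩ := exists_eq_mul_pow' hgen x
    obtain ⟨b, n, rfl⟩ := exists_eq_mul_pow' hgen y
    rw [commutatorElement_eq A a b ((Commute.refl g).pow_pow m n)]
    exact SetLike.coe_mem _
  haveI hGjn : Gj.Normal := normal_of_commutator_le' (hcommA.trans hAGj)
  have hGjeq : Gj = A ⊔ Subgroup.zpowers gj := layer_eq_sup_zpowers hgA hgen hind hj hAGj hGj
  have hGjelt : ∀ x ∈ Gj, ∃ a : A, ∃ m : ℕ, x = (a : G) * gj ^ m := fun x hx =>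
    exists_eq_mul_pow_of_mem (by rwa [← hGjeq])
  have hgjGj : gj ∈ Gj := by rw [hGjeq]; exact Subgroup.mem_sup_right (Subgroup.mem_zpowers gj)
  have hgjA : Subgroup.zpowers gj ⊓ A = ⊥ := by
    rw [eq_bot_iff, ← hgA]
    exact inf_le_inf_right A ((Subgroup.zpowers_le).mpr (Subgroup.npow_mem_zpowers g _))
  have hDW : ∀ x : Additive A, (φ - 1) x ∈ W₀ := fun x => by
    rw [hW₀]; exact Submodule.subset_span (Or.inl ⟨x, rfl⟩)
  have haW : ∀ (a : A) (I : Subgroup G), I ∈ 𝓘 → (a : G) * g ∈ I → Additive.ofMul a ∈ W₀ := fun a I hI haI => by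
    rw [hW₀]; exact Submodule.subset_span (Or.inr ⟨I, hI, by simpa using haI⟩)
  -- `W₀` and any submodule containing `(φ - 1)A` is `φ`-stable
  have stab_of : ∀ S : Submodule ℤ (Additive A), (∀ x, (φ - 1) x ∈ S) → ∀ y ∈ S, φ y ∈ S := by
    intro S hS y hy
    have : φ y = (φ - 1) y + y := by simp
    rw [this]; exact S.add_mem (hS y) hy
  have hφcomm : ∀ n m : ℕ, Commute (φ ^ n) (φ ^ m) := fun n m => Commute.pow_pow_self φ n m
  have hνcomm : ∀ n : ℕ, φ ^ n * ν = ν * φ ^ n := fun n =>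
    (Commute.sum_right _ _ _ fun i _ => hφcomm n i).eq
  have hDν : ∀ x, (φ - 1) (ν x) = ν ((φ - 1) x) := fun x => by
    have : (φ - 1) * ν = ν * (φ - 1) := by rw [sub_mul, mul_sub, one_mul, mul_one, ← pow_one φ, hνcomm 1]
    rw [← Module.End.mul_apply, this, Module.End.mul_apply]
  -- the two candidate submodules and their stability
  set W : Submodule ℤ (Additive A) := W₀.map ν with hW
  set π : Module.End ℤ (Additive A) := (p : ℤ) • (1 : Module.End ℤ (Additive A)) with hπ
  set W' : Submodule ℤ (Additive A) := W ⊔ (⊤ : Submodule ℤ (Additive A)).map π with hW'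
  have hDWmem : ∀ x, (φ - 1) x ∈ W → True := fun _ _ => trivial
  have hWstab : ∀ y ∈ W, φ y ∈ W := by
    intro y hy
    obtain ⟨x, hx, rfl⟩ := Submodule.mem_map.mp hy
    rw [← Module.End.mul_apply, ← pow_one φ, hνcomm, Module.End.mul_apply, pow_one]
    exact Submodule.mem_map_of_mem (stab_of W₀ hDW x hx)
  have hW'stab : ∀ y ∈ W', φ y ∈ W' := by
    intro y hy
    obtain ⟨w, hw, z, hz, rfl⟩ := Submodule.mem_sup.mp hy
    rw [map_add]
    refine W'.add_mem (Submodule.mem_sup_left (hWstab w hw)) (Submodule.mem_sup_right ?_)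
    obtain ⟨u, -, rfl⟩ := Submodule.mem_map.mp hz
    refine Submodule.mem_map.mpr ⟨φ u, Submodule.mem_top, ?_⟩
    rw [hπ, LinearMap.smul_apply, LinearMap.smul_apply, Module.End.one_apply, Module.End.one_apply, map_zsmul]
  haveI hLn : (liftSub A W).Normal := liftSub_normal hgen hWstab
  haveI hL'n : (liftSub A W').Normal := liftSub_normal hgen hW'stab
  -- `(φ^{p^j m} - 1) x ∈ ν(W₀)` (Washington Lemma 13.18)
  have hkey : ∀ (m : ℕ) (x : Additive A), (φ ^ (p ^ j * m) - 1) x ∈ W := by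
    intro m x
    rw [pow_mul_sub_one_eq φ (p ^ j) m, ← hν, Module.End.mul_apply]
    exact Submodule.mem_map_of_mem (by rw [Module.End.mul_apply]; exact hDW _)
  have hconj_pow : ∀ m : ℕ, conjEnd A (gj ^ m) = φ ^ (p ^ j * m) := fun m => by
    rw [hgj, ← pow_mul, conjEnd_pow']
  -- ### (1) `Nj ≤ liftSub W ⊔ ⟨gj⟩`
  set T : Subgroup G := liftSub A W ⊔ Subgroup.zpowers gj with hT
  set T' : Subgroup G := liftSub A W' ⊔ Subgroup.zpowers gj with hT'
  have hTT' : T ≤ T' := sup_le_sup_right (liftSub_mono A le_sup_left) _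
  have hcommT : ⁅Gj, Gj⁆ ≤ T := by
    rw [Subgroup.commutator_le]
    intro x hx y hy
    obtain ⟨a, m₁, rfl⟩ := hGjelt x hx
    obtain ⟨b, m₂, rfl⟩ := hGjelt y hy
    rw [commutatorElement_eq A a b ((Commute.refl gj).pow_pow _ _)]
    refine Subgroup.mem_sup_left ((toMul_mem_liftSub_iff A _).mpr ?_)
    rw [hconj_pow, hconj_pow]
    exact Submodule.sub_mem _ (hkey m₁ _) (hkey m₂ _)
  have hIT : ∀ I ∈ 𝓘, I ⊓ Gj ≤ T := by
    intro I hI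
    obtain ⟨hIA, hI0 | hI0⟩ := h𝓘 I hI
    · rw [hI0, bot_inf_eq]; exact bot_le
    · obtain ⟨a, haI, hgenI⟩ := exists_generator_of_complement (p := p) hgen hIA hI0
      intro x hx
      obtain ⟨m, rfl⟩ := hgenI hAGj hGj x hx
      refine T.pow_mem ?_ m
      -- `(a g)^{p^j} = ν(a) · gj`
      rw [coe_mul_pow_eq A g a (p ^ j), ← hφ, ← hν]
      refine Subgroup.mul_mem_sup ((toMul_mem_liftSub_iff A _).mpr ?_) (Subgroup.mem_zpowers _)
      exact Submodule.mem_map_of_mem (haW a I hI haI)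
  have hNjT : Nj ≤ T := sup_le hcommT (iSup₂_le hIT)
  -- ### (2) `liftSub W ⊔ ⟨gj⟩ ≤ Nj`
  have hgjNj : gj ∈ Nj := by
    have h1 : gj ∈ Subgroup.zpowers g ⊓ Gj := ⟨Subgroup.npow_mem_zpowers g _, hgjGj⟩
    exact le_sup_of_le_right (le_iSup₂ (f := fun I (_ : I ∈ 𝓘) => I ⊓ Gj) _ hg𝓘) h1
  have hcommNj : ⁅Gj, Gj⁆ ≤ Nj := le_sup_left
  have hWNj : W ≤ subOf A Nj := by
    rw [hW, Submodule.map_le_iff_le_comap, hW₀, Submodule.span_le]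
    rintro x (⟨y, rfl⟩ | ⟨I, hI, hxI⟩)
    · -- `ν((φ - 1) y) = (φ^{p^j} - 1) y = ⁅gj, y⁆ ∈ Gj'`
      rw [SetLike.mem_coe, Submodule.mem_comap, mem_subOf']
      have h1 : ν ((φ - 1) y) = (conjEnd A gj - 1) y := by
        rw [hgj, conjEnd_pow', ← hφ, ← mul_one (p ^ j), pow_mul_sub_one_eq φ (p ^ j) 1, ← hν]
        simp [Module.End.mul_apply]
      have h2 := commutatorElement_eq' A gj (Additive.toMul y)
      rw [ofMul_toMul] at h2
      rw [h1, ← h2]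
      exact hcommNj (Subgroup.commutator_mem_commutator hgjGj (hAGj (SetLike.coe_mem _)))
    · -- `ν(a) = (a g)^{p^j} gj⁻¹ ∈ Nj`
      rw [SetLike.mem_coe, Submodule.mem_comap, mem_subOf']
      have h1 : ((Additive.toMul (ν x) : A) : G) = (((Additive.toMul x : A) : G) * g) ^ p ^ j * gj⁻¹ := by
        rw [coe_mul_pow_eq A g (Additive.toMul x) (p ^ j), ofMul_toMul, ← hφ, ← hν, hgj, mul_inv_cancel_right]
      rw [h1]
      refine Nj.mul_mem ?_ (Nj.inv_mem hgjNj)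
      have h2 : (((Additive.toMul x : A) : G) * g) ^ p ^ j ∈ I ⊓ Gj :=
        ⟨I.pow_mem hxI _, pow_mem_layer hgen hAGj hGj _⟩
      exact le_sup_of_le_right (le_iSup₂ (f := fun I (_ : I ∈ 𝓘) => I ⊓ Gj) I hI) h2
  have hTNj : T ≤ Nj := sup_le ((liftSub_le_iff A).mpr hWNj) ((Subgroup.zpowers_le).mpr hgjNj)
  have hNjeq : Nj = T := le_antisymm hNjT hTNj
  refine ⟨hNjeq, ?_⟩
  -- ### (3) the `p`-th powers: `Nj ⊔ Pj = liftSub W' ⊔ ⟨gj⟩`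
  apply le_antisymm
  · refine sup_le (hNjeq ▸ hTT') ?_
    rw [hPj, Subgroup.closure_le]
    rintro _ ⟨x, hx, rfl⟩
    obtain ⟨a, m, rfl⟩ := hGjelt x hx
    -- `(a gj^m)^p = (∑_{i<p} φ^{p^j m i})(a) · gj^{mp}` and `(∑_{i<p} φ^{p^j m i})(a) - p a ∈ W`
    change ((a : G) * gj ^ m) ^ p ∈ T'
    rw [coe_mul_pow_eq A (gj ^ m) a p]
    refine Subgroup.mul_mem_sup ((toMul_mem_liftSub_iff A _).mpr ?_) ?_
    · have h1 : ∀ i : ℕ, (conjEnd A (gj ^ m) ^ i) (Additive.ofMul a) =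
          (φ ^ (p ^ j * (m * i)) - 1) (Additive.ofMul a) + Additive.ofMul a := fun i => by
        rw [hconj_pow, ← pow_mul, mul_assoc, LinearMap.sub_apply, Module.End.one_apply, sub_add_cancel]
      rw [LinearMap.sum_apply, Finset.sum_congr rfl fun i _ => h1 i, Finset.sum_add_distrib, Finset.sum_const,
        Finset.card_range]
      refine W'.add_mem (Submodule.mem_sup_left (W.sum_mem fun i _ => hkey (m * i) _)) (Submodule.mem_sup_right ?_)
      refine Submodule.mem_map.mpr ⟨Additive.ofMul a, Submodule.mem_top, ?_⟩
      rw [hπ, LinearMap.smul_apply, Module.End.one_apply, natCast_zsmul]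
    · rw [← pow_mul]; exact Subgroup.mem_zpowers_iff.mpr ⟨(m * p : ℕ), by rw [zpow_natCast]⟩
  · refine sup_le ?_ ((Subgroup.zpowers_le).mpr (Subgroup.mem_sup_left hgjNj))
    rw [hW', liftSub_sup]
    refine sup_le (fun x hx => Subgroup.mem_sup_left (hTNj (Subgroup.mem_sup_left hx))) ?_
    intro x hx
    obtain ⟨y, hy, rfl⟩ := (mem_liftSub' A).mp hx
    obtain ⟨u, -, hu⟩ := Submodule.mem_map.mp hy
    refine Subgroup.mem_sup_right (Subgroup.subset_closure ⟨((Additive.toMul u : A) : G), hAGj (SetLike.coe_mem _), ?_⟩)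
    change ((Additive.toMul u : A) : G) ^ p = (y : G)
    have h3 : Additive.ofMul y = p • u := by
      rw [← hu, hπ, LinearMap.smul_apply, Module.End.one_apply, natCast_zsmul]
    rw [← Subgroup.coe_pow, ← toMul_nsmul, ← h3, toMul_ofMul]

/-- **`Y₀ = N₀ ∩ A` is the span of `(φ − 1)A` and of the `a_I`** (`a_I ∈ A` with `a_I g ∈ I`, `I ∈ 𝓘`): Washington's definition of `Y₀`
(Lemma 13.15) agrees with `N₀ ∩ A`, `N₀ = G'·⟨I : I ∈ 𝓘⟩`. [cite: Washington1997, §13.3 Lemma 13.15] -/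
theorem subOf_commutator_sup_eq_span (hgA : Subgroup.zpowers g ⊓ A = ⊥) (hgen : A ⊔ Subgroup.zpowers g = ⊤)
    (hind : A.index = p ^ t) (h𝓘 : ∀ I ∈ 𝓘, I ⊓ A = ⊥ ∧ (I = ⊥ ∨ I ⊔ A = ⊤)) (hg𝓘 : Subgroup.zpowers g ∈ 𝓘) :
    subOf A (⁅(⊤ : Subgroup G), ⊤⁆ ⊔ ⨆ I ∈ 𝓘, I) =
      Submodule.span ℤ (Set.range ⇑(conjEnd A g - 1) ∪ {x | ∃ I ∈ 𝓘, ((Additive.toMul x : A) : G) * g ∈ I}) := by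
  have h := (commutator_sup_layer_eq_aux hgA hgen hind h𝓘 hg𝓘 _ rfl (Nat.zero_le t) (Gj := ⊤) le_top
    (by rw [Subgroup.index_top, pow_zero])).1
  have hmap1 : ∀ S : Submodule ℤ (Additive A), S.map (1 : Module.End ℤ (Additive A)) = S := fun S => by
    ext x; simp [Submodule.mem_map]
  simp only [inf_top_eq, pow_zero, Finset.range_one, Finset.sum_singleton, pow_one, hmap1] at h
  have hstab : ∀ y ∈ Submodule.span ℤ (Set.range ⇑(conjEnd A g - 1) ∪ {x | ∃ I ∈ 𝓘, ((Additive.toMul x : A) : G) * g ∈ I}),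
      conjEnd A g y ∈ Submodule.span ℤ (Set.range ⇑(conjEnd A g - 1) ∪ {x | ∃ I ∈ 𝓘, ((Additive.toMul x : A) : G) * g ∈ I}) := by
    intro y hy
    have : conjEnd A g y = (conjEnd A g - 1) y + y := by simp
    rw [this]
    exact Submodule.add_mem _ (Submodule.subset_span (Or.inl ⟨y, rfl⟩)) hy
  haveI := liftSub_normal hgen hstab
  rw [← subOf_inf, h, liftSub_sup_zpowers_inf_eq hgA, subOf_liftSub]

/-- `(φ − 1)x ∈ Y₀` for every `x ∈ A` (`G' = (σ − 1)X`, Washington Lemma 13.15). [cite: Washington1997, §13.3 Lemma 13.15] -/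
theorem map_sub_one_mem_subOf_commutator_sup (hgA : Subgroup.zpowers g ⊓ A = ⊥) (hgen : A ⊔ Subgroup.zpowers g = ⊤)
    (hind : A.index = p ^ t) (h𝓘 : ∀ I ∈ 𝓘, I ⊓ A = ⊥ ∧ (I = ⊥ ∨ I ⊔ A = ⊤)) (hg𝓘 : Subgroup.zpowers g ∈ 𝓘)
    (x : Additive A) : (conjEnd A g - 1) x ∈ subOf A (⁅(⊤ : Subgroup G), ⊤⁆ ⊔ ⨆ I ∈ 𝓘, I) := by
  rw [subOf_commutator_sup_eq_span hgA hgen hind h𝓘 hg𝓘]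
  exact Submodule.subset_span (Or.inl ⟨x, rfl⟩)

/-- `Y₀` is `φ`-stable. [cite: Washington1997, §13.3 Lemma 13.15] -/
theorem conjEnd_mem_subOf_commutator_sup (hgA : Subgroup.zpowers g ⊓ A = ⊥) (hgen : A ⊔ Subgroup.zpowers g = ⊤)
    (hind : A.index = p ^ t) (h𝓘 : ∀ I ∈ 𝓘, I ⊓ A = ⊥ ∧ (I = ⊥ ∨ I ⊔ A = ⊤)) (hg𝓘 : Subgroup.zpowers g ∈ 𝓘)
    {y : Additive A} (hy : y ∈ subOf A (⁅(⊤ : Subgroup G), ⊤⁆ ⊔ ⨆ I ∈ 𝓘, I)) :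
    conjEnd A g y ∈ subOf A (⁅(⊤ : Subgroup G), ⊤⁆ ⊔ ⨆ I ∈ 𝓘, I) := by
  have : conjEnd A g y = (conjEnd A g - 1) y + y := by simp
  rw [this]
  exact Submodule.add_mem _ (map_sub_one_mem_subOf_commutator_sup hgA hgen hind h𝓘 hg𝓘 y) hy

/-- **`N_j = ν_j(Y₀)·⟨g^{p^j}⟩`** for the subgroup `G_j ⊇ A` of index `p^j`, `N_j = G_j'·⟨I ∩ G_j : I ∈ 𝓘⟩` (Washington Lemmas 13.15/13.18
at finite level, both inclusions). [cite: Washington1997, §13.3 Lemmas 13.15 and 13.18] -/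
theorem commutator_sup_layer_eq (hgA : Subgroup.zpowers g ⊓ A = ⊥) (hgen : A ⊔ Subgroup.zpowers g = ⊤)
    (hind : A.index = p ^ t) (h𝓘 : ∀ I ∈ 𝓘, I ⊓ A = ⊥ ∧ (I = ⊥ ∨ I ⊔ A = ⊤)) (hg𝓘 : Subgroup.zpowers g ∈ 𝓘)
    {j : ℕ} (hj : j ≤ t) {Gj : Subgroup G} (hAGj : A ≤ Gj) (hGj : Gj.index = p ^ j) :
    ⁅Gj, Gj⁆ ⊔ ⨆ I ∈ 𝓘, I ⊓ Gj =
      liftSub A ((subOf A (⁅(⊤ : Subgroup G), ⊤⁆ ⊔ ⨆ I ∈ 𝓘, I)).map (∑ i ∈ range (p ^ j), conjEnd A g ^ i)) ⊔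
        Subgroup.zpowers (g ^ p ^ j) := by
  rw [subOf_commutator_sup_eq_span hgA hgen hind h𝓘 hg𝓘]
  exact (commutator_sup_layer_eq_aux hgA hgen hind h𝓘 hg𝓘 _ rfl hj hAGj hGj).1

/-- `ν_j(Y₀)` is `φ`-stable (hence `liftSub (ν_j Y₀)` is normal). [cite: Washington1997, §13.3 Lemma 13.18] -/
theorem conjEnd_mem_map_subOf_commutator_sup (hgA : Subgroup.zpowers g ⊓ A = ⊥) (hgen : A ⊔ Subgroup.zpowers g = ⊤)
    (hind : A.index = p ^ t) (h𝓘 : ∀ I ∈ 𝓘, I ⊓ A = ⊥ ∧ (I = ⊥ ∨ I ⊔ A = ⊤)) (hg𝓘 : Subgroup.zpowers g ∈ 𝓘) (j : ℕ)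
    {y : Additive A} (hy : y ∈ (subOf A (⁅(⊤ : Subgroup G), ⊤⁆ ⊔ ⨆ I ∈ 𝓘, I)).map (∑ i ∈ range (p ^ j), conjEnd A g ^ i)) :
    conjEnd A g y ∈ (subOf A (⁅(⊤ : Subgroup G), ⊤⁆ ⊔ ⨆ I ∈ 𝓘, I)).map (∑ i ∈ range (p ^ j), conjEnd A g ^ i) := by
  obtain ⟨x, hx, rfl⟩ := Submodule.mem_map.mp hy
  have hcomm : conjEnd A g * ∑ i ∈ range (p ^ j), conjEnd A g ^ i = (∑ i ∈ range (p ^ j), conjEnd A g ^ i) * conjEnd A g := by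
    rw [Finset.mul_sum, Finset.sum_mul]
    exact Finset.sum_congr rfl fun i _ => by rw [← pow_succ', ← pow_succ]
  rw [← Module.End.mul_apply, hcomm, Module.End.mul_apply]
  exact Submodule.mem_map_of_mem (conjEnd_mem_subOf_commutator_sup hgA hgen hind h𝓘 hg𝓘 hx)

/-- **`N_j ∩ A = ν_j(Y₀)`** (as `liftSub`). [cite: Washington1997, §13.3 Lemmas 13.15 and 13.18] -/
theorem commutator_sup_layer_inf_eq (hgA : Subgroup.zpowers g ⊓ A = ⊥) (hgen : A ⊔ Subgroup.zpowers g = ⊤)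
    (hind : A.index = p ^ t) (h𝓘 : ∀ I ∈ 𝓘, I ⊓ A = ⊥ ∧ (I = ⊥ ∨ I ⊔ A = ⊤)) (hg𝓘 : Subgroup.zpowers g ∈ 𝓘)
    {j : ℕ} (hj : j ≤ t) {Gj : Subgroup G} (hAGj : A ≤ Gj) (hGj : Gj.index = p ^ j) :
    (⁅Gj, Gj⁆ ⊔ ⨆ I ∈ 𝓘, I ⊓ Gj) ⊓ A =
      liftSub A ((subOf A (⁅(⊤ : Subgroup G), ⊤⁆ ⊔ ⨆ I ∈ 𝓘, I)).map (∑ i ∈ range (p ^ j), conjEnd A g ^ i)) := by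
  haveI := liftSub_normal hgen (fun y hy => conjEnd_mem_map_subOf_commutator_sup hgA hgen hind h𝓘 hg𝓘 j hy)
  have hgjA : Subgroup.zpowers (g ^ p ^ j) ⊓ A = ⊥ := by
    rw [eq_bot_iff, ← hgA]
    exact inf_le_inf_right A ((Subgroup.zpowers_le).mpr (Subgroup.npow_mem_zpowers g _))
  rw [commutator_sup_layer_eq hgA hgen hind h𝓘 hg𝓘 hj hAGj hGj, liftSub_sup_zpowers_inf_eq hgjA]

/-- **`[G_j : N_j] · #ν_j(Y₀) = #A`** («`X/ν_n Y₀ ≅ A_n`» at finite level, cardinality form). [cite: Washington1997, §13.3 Lemma 13.18] -/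
theorem relIndex_commutator_sup_layer_mul_card (hgA : Subgroup.zpowers g ⊓ A = ⊥) (hgen : A ⊔ Subgroup.zpowers g = ⊤)
    (hind : A.index = p ^ t) (h𝓘 : ∀ I ∈ 𝓘, I ⊓ A = ⊥ ∧ (I = ⊥ ∨ I ⊔ A = ⊤)) (hg𝓘 : Subgroup.zpowers g ∈ 𝓘)
    {j : ℕ} (hj : j ≤ t) {Gj : Subgroup G} (hAGj : A ≤ Gj) (hGj : Gj.index = p ^ j) :
    (⁅Gj, Gj⁆ ⊔ ⨆ I ∈ 𝓘, I ⊓ Gj).relIndex Gj *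
        Nat.card ((subOf A (⁅(⊤ : Subgroup G), ⊤⁆ ⊔ ⨆ I ∈ 𝓘, I)).map (∑ i ∈ range (p ^ j), conjEnd A g ^ i)) =
      Nat.card A := by
  rw [← card_liftSub' A, ← commutator_sup_layer_inf_eq hgA hgen hind h𝓘 hg𝓘 hj hAGj hGj]
  have hGjeq := layer_eq_sup_zpowers hgA hgen hind hj hAGj hGj
  refine relIndex_mul_card_inf_eq' (A := A) ?_ hAGj ?_
  · refine sup_le ?_ (iSup₂_le fun I _ => inf_le_right)
    rw [Subgroup.commutator_le]
    exact fun x hx y hy => Gj.mul_mem (Gj.mul_mem (Gj.mul_mem hx hy) (Gj.inv_mem hx)) (Gj.inv_mem hy)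
  · apply le_antisymm
    · refine sup_le hAGj (sup_le ?_ (iSup₂_le fun I _ => inf_le_right))
      rw [Subgroup.commutator_le]
      exact fun x hx y hy => Gj.mul_mem (Gj.mul_mem (Gj.mul_mem hx hy) (Gj.inv_mem hx)) (Gj.inv_mem hy)
    · have h1 : g ^ p ^ j ∈ Subgroup.zpowers g ⊓ Gj :=
        ⟨Subgroup.npow_mem_zpowers g _, hGjeq ▸ Subgroup.mem_sup_right (Subgroup.mem_zpowers _)⟩
      have h2 : g ^ p ^ j ∈ ⁅Gj, Gj⁆ ⊔ ⨆ I ∈ 𝓘, I ⊓ Gj :=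
        le_sup_of_le_right (le_iSup₂ (f := fun I (_ : I ∈ 𝓘) => I ⊓ Gj) _ hg𝓘) h1
      calc Gj = A ⊔ Subgroup.zpowers (g ^ p ^ j) := hGjeq
        _ ≤ _ := sup_le le_sup_left ((Subgroup.zpowers_le).mpr (Subgroup.mem_sup_right h2))

/-- **`N_j·P_j = (ν_j(Y₀) + pA)·⟨g^{p^j}⟩`**, `P_j` the subgroup generated by the `p`-th powers of `G_j` (the elementary-abelian companion of
Lemma 13.18: `X/(ν_n Y₀ + pX) ≅ A_n/pA_n`). [cite: Washington1997, §13.3 Lemma 13.18] [cite: Fukuda1994, Thm. 1 (2), p. 264 (proof)] -/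
theorem commutator_sup_layer_pow_eq (hgA : Subgroup.zpowers g ⊓ A = ⊥) (hgen : A ⊔ Subgroup.zpowers g = ⊤)
    (hind : A.index = p ^ t) (h𝓘 : ∀ I ∈ 𝓘, I ⊓ A = ⊥ ∧ (I = ⊥ ∨ I ⊔ A = ⊤)) (hg𝓘 : Subgroup.zpowers g ∈ 𝓘)
    {j : ℕ} (hj : j ≤ t) {Gj : Subgroup G} (hAGj : A ≤ Gj) (hGj : Gj.index = p ^ j) :
    (⁅Gj, Gj⁆ ⊔ ⨆ I ∈ 𝓘, I ⊓ Gj) ⊔ Subgroup.closure ((fun x : G => x ^ p) '' (Gj : Set G)) =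
      liftSub A ((subOf A (⁅(⊤ : Subgroup G), ⊤⁆ ⊔ ⨆ I ∈ 𝓘, I)).map (∑ i ∈ range (p ^ j), conjEnd A g ^ i) ⊔
          (⊤ : Submodule ℤ (Additive A)).map ((p : ℤ) • (1 : Module.End ℤ (Additive A)))) ⊔ Subgroup.zpowers (g ^ p ^ j) := by
  rw [subOf_commutator_sup_eq_span hgA hgen hind h𝓘 hg𝓘]
  exact (commutator_sup_layer_eq_aux hgA hgen hind h𝓘 hg𝓘 _ rfl hj hAGj hGj).2

/-- **`N_j·P_j ∩ A = ν_j(Y₀) + pA`** (as `liftSub`). [cite: Washington1997, §13.3 Lemma 13.18] [cite: Fukuda1994, Thm. 1 (2), p. 264 (proof)] -/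
theorem commutator_sup_layer_pow_inf_eq (hgA : Subgroup.zpowers g ⊓ A = ⊥) (hgen : A ⊔ Subgroup.zpowers g = ⊤)
    (hind : A.index = p ^ t) (h𝓘 : ∀ I ∈ 𝓘, I ⊓ A = ⊥ ∧ (I = ⊥ ∨ I ⊔ A = ⊤)) (hg𝓘 : Subgroup.zpowers g ∈ 𝓘)
    {j : ℕ} (hj : j ≤ t) {Gj : Subgroup G} (hAGj : A ≤ Gj) (hGj : Gj.index = p ^ j) :
    ((⁅Gj, Gj⁆ ⊔ ⨆ I ∈ 𝓘, I ⊓ Gj) ⊔ Subgroup.closure ((fun x : G => x ^ p) '' (Gj : Set G))) ⊓ A =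
      liftSub A ((subOf A (⁅(⊤ : Subgroup G), ⊤⁆ ⊔ ⨆ I ∈ 𝓘, I)).map (∑ i ∈ range (p ^ j), conjEnd A g ^ i) ⊔
        (⊤ : Submodule ℤ (Additive A)).map ((p : ℤ) • (1 : Module.End ℤ (Additive A)))) := by
  have hstab : ∀ y ∈ (subOf A (⁅(⊤ : Subgroup G), ⊤⁆ ⊔ ⨆ I ∈ 𝓘, I)).map (∑ i ∈ range (p ^ j), conjEnd A g ^ i) ⊔
      (⊤ : Submodule ℤ (Additive A)).map ((p : ℤ) • (1 : Module.End ℤ (Additive A))),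
      conjEnd A g y ∈ (subOf A (⁅(⊤ : Subgroup G), ⊤⁆ ⊔ ⨆ I ∈ 𝓘, I)).map (∑ i ∈ range (p ^ j), conjEnd A g ^ i) ⊔
        (⊤ : Submodule ℤ (Additive A)).map ((p : ℤ) • (1 : Module.End ℤ (Additive A))) := by
    intro y hy
    obtain ⟨w, hw, z, hz, rfl⟩ := Submodule.mem_sup.mp hy
    rw [map_add]
    refine Submodule.add_mem _ (Submodule.mem_sup_left (conjEnd_mem_map_subOf_commutator_sup hgA hgen hind h𝓘 hg𝓘 j hw))
      (Submodule.mem_sup_right ?_)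
    obtain ⟨u, -, rfl⟩ := Submodule.mem_map.mp hz
    refine Submodule.mem_map.mpr ⟨conjEnd A g u, Submodule.mem_top, ?_⟩
    rw [LinearMap.smul_apply, LinearMap.smul_apply, Module.End.one_apply, Module.End.one_apply, map_zsmul]
  haveI := liftSub_normal hgen hstab
  have hgjA : Subgroup.zpowers (g ^ p ^ j) ⊓ A = ⊥ := by
    rw [eq_bot_iff, ← hgA]
    exact inf_le_inf_right A ((Subgroup.zpowers_le).mpr (Subgroup.npow_mem_zpowers g _))
  rw [commutator_sup_layer_pow_eq hgA hgen hind h𝓘 hg𝓘 hj hAGj hGj, liftSub_sup_zpowers_inf_eq hgjA]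

/-- **`[G_j : N_j P_j] · #(ν_j(Y₀) + pA) = #A`** (`rank_p A_n = dim A/(ν_n Y₀ + pA)` at finite level, cardinality form).
[cite: Washington1997, §13.3 Lemma 13.18] [cite: Fukuda1994, Thm. 1 (2), p. 264 (proof)] -/
theorem relIndex_commutator_sup_layer_pow_mul_card (hgA : Subgroup.zpowers g ⊓ A = ⊥) (hgen : A ⊔ Subgroup.zpowers g = ⊤)
    (hind : A.index = p ^ t) (h𝓘 : ∀ I ∈ 𝓘, I ⊓ A = ⊥ ∧ (I = ⊥ ∨ I ⊔ A = ⊤)) (hg𝓘 : Subgroup.zpowers g ∈ 𝓘)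
    {j : ℕ} (hj : j ≤ t) {Gj : Subgroup G} (hAGj : A ≤ Gj) (hGj : Gj.index = p ^ j) :
    ((⁅Gj, Gj⁆ ⊔ ⨆ I ∈ 𝓘, I ⊓ Gj) ⊔ Subgroup.closure ((fun x : G => x ^ p) '' (Gj : Set G))).relIndex Gj *
        Nat.card ↥((subOf A (⁅(⊤ : Subgroup G), ⊤⁆ ⊔ ⨆ I ∈ 𝓘, I)).map (∑ i ∈ range (p ^ j), conjEnd A g ^ i) ⊔
          (⊤ : Submodule ℤ (Additive A)).map ((p : ℤ) • (1 : Module.End ℤ (Additive A)))) =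
      Nat.card A := by
  rw [← card_liftSub' A, ← commutator_sup_layer_pow_inf_eq hgA hgen hind h𝓘 hg𝓘 hj hAGj hGj]
  have hGjeq := layer_eq_sup_zpowers hgA hgen hind hj hAGj hGj
  have hNjGj : ⁅Gj, Gj⁆ ⊔ ⨆ I ∈ 𝓘, I ⊓ Gj ≤ Gj := by
    refine sup_le ?_ (iSup₂_le fun I _ => inf_le_right)
    rw [Subgroup.commutator_le]
    exact fun x hx y hy => Gj.mul_mem (Gj.mul_mem (Gj.mul_mem hx hy) (Gj.inv_mem hx)) (Gj.inv_mem hy)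
  have hPjGj : Subgroup.closure ((fun x : G => x ^ p) '' (Gj : Set G)) ≤ Gj := by
    rw [Subgroup.closure_le]
    rintro _ ⟨x, hx, rfl⟩
    exact Gj.pow_mem hx p
  refine relIndex_mul_card_inf_eq' (A := A) (sup_le hNjGj hPjGj) hAGj ?_
  apply le_antisymm
  · exact sup_le hAGj (sup_le hNjGj hPjGj)
  · have h1 : g ^ p ^ j ∈ Subgroup.zpowers g ⊓ Gj :=
      ⟨Subgroup.npow_mem_zpowers g _, hGjeq ▸ Subgroup.mem_sup_right (Subgroup.mem_zpowers _)⟩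
    have h2 : g ^ p ^ j ∈ ⁅Gj, Gj⁆ ⊔ ⨆ I ∈ 𝓘, I ⊓ Gj :=
      le_sup_of_le_right (le_iSup₂ (f := fun I (_ : I ∈ 𝓘) => I ⊓ Gj) _ hg𝓘) h1
    calc Gj = A ⊔ Subgroup.zpowers (g ^ p ^ j) := hGjeq
      _ ≤ _ := sup_le le_sup_left ((Subgroup.zpowers_le).mpr (Subgroup.mem_sup_right (Subgroup.mem_sup_left h2)))

/-- **`ν_t(Y₀) = 0`** for `p^t = [G : A]`: `ν_t((φ − 1)x) = (φ^{p^t} − 1)x = 0` and `ν_t(a_I) g^{p^t} = (a_I g)^{p^t} ∈ I ∩ A = 1`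
(at the top layer the norm group is trivial: `H_p/K_{n+t}` is abelian and unramified). [cite: Washington1997, §13.3 Lemma 13.18] -/
theorem map_subOf_commutator_sup_index_eq_bot (hgA : Subgroup.zpowers g ⊓ A = ⊥) (hgen : A ⊔ Subgroup.zpowers g = ⊤)
    (hind : A.index = p ^ t) (h𝓘 : ∀ I ∈ 𝓘, I ⊓ A = ⊥ ∧ (I = ⊥ ∨ I ⊔ A = ⊤)) (hg𝓘 : Subgroup.zpowers g ∈ 𝓘) :
    (subOf A (⁅(⊤ : Subgroup G), ⊤⁆ ⊔ ⨆ I ∈ 𝓘, I)).map (∑ i ∈ range (p ^ t), conjEnd A g ^ i) = ⊥ := by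
  -- `N_t ∩ A = 1` for `G_t = A`: commutators of `A` are trivial and `I ∩ A = 1`
  have h := commutator_sup_layer_inf_eq hgA hgen hind h𝓘 hg𝓘 le_rfl (Gj := A) le_rfl hind
  have hN : (⁅A, A⁆ ⊔ ⨆ I ∈ 𝓘, I ⊓ A) = ⊥ := by
    rw [eq_bot_iff]
    refine sup_le ?_ (iSup₂_le fun I hI => by rw [(h𝓘 I hI).1])
    rw [Subgroup.commutator_le]
    intro x hx y hy
    rw [Subgroup.mem_bot, commutatorElement_def, setLike_mul_comm hx hy, mul_inv_cancel_right, mul_inv_cancel]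
  rw [hN, bot_inf_eq] at h
  rw [← subOf_liftSub A ((subOf A (⁅(⊤ : Subgroup G), ⊤⁆ ⊔ ⨆ I ∈ 𝓘, I)).map _), ← h]
  ext x
  rw [mem_subOf', Subgroup.mem_bot, Submodule.mem_bot]
  constructor
  · intro hx
    apply Additive.toMul.injective
    exact Subtype.ext hx
  · rintro rfl; rfl

end Layers

end Literature.NumberTheory.IwasawaTheory.FukudaGroup

end
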